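import Summits.NavierStokesRegularity.NavierStokesRegularity.Theorems.SqueezeCycleExtremalElementExistsRegularity
import Summits.NavierStokesRegularity.NavierStokesRegularity.Theorems.CorkscrewDynamoCorkscrewProfileRdssWitness
import Literature.Analysis.FluidPDE.AncientMildCompactness
import Summits.NavierStokesRegularity.NavierStokesRegularity.Theorems.TypeICertificateLadderTargetRssCompactnessLimit
import Literature.Analysis.FluidPDE.AxisymmetricVorticityTransport
import Literature.Analysis.FluidPDE.SelfSimilar
import HarnessLib

/-!
# Route CorkscrewDynamo · crux `CorkscrewProfile` (stmt-NavierStokesRegularity-11282) — KNSS Lemma 6.1 compactness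
# along tuned exponents for rotated-DSS Oseen-gauge fields (lead c4, line `registered`, tool stub F4)

Registered tool stub `stub_rdssTunedCompactness` of the near-identity rigidity theorem. Let `V_n` be NONTRIVIAL
Oseen-gauge Type-I fields (`IsTypeIAncientMild C₀ (V n)`, `HasTypeIDecay C₀ (V n)`), each rotated `c_n`-DSS about
`e₃` through `rotZLIE θ_n`, with `1 < c_n ≤ 2`, `c_n → 1`, and suppose that for every `μ ≥ 1` exponents `k_n : ℕ`
and integers `m_n` are given with `c_n^{k_n} → μ` and `k_n θ_n − 2π m_n → Θ μ` (TUNED EXPONENTS with a prescribed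
angle function `Θ`). Then there is a limit field `W` with `IsTypeIAncientMild C₀ W`, `HasTypeIDecay C₀ W`, `W = 0` on
`t ≥ 0`, which is rotated `μ`-DSS through `rotZLIE (Θ μ)` for EVERY `μ ≥ 1`, and `W(−1, x̄) ≠ 0` for some `x̄`.

Proof. KNSS 2009 Lemma 6.1 in the tree's symmetry-free rate form (`KNSS2009_lemma61_typeI_rate`) extracts a
subsequence converging pointwise on the open past and uniformly on the compact slab pieces
`[−(N+2), −1/(N+2)] × B̄(0, N+2)` to a continuous Oseen-mild field `W₀` with the same rate, which is a member of
`IsTypeIAncientMild C₀` (`isTypeIAncientMild_of_continuous_oseenMild`, KNSS Prop. 4.1); the pointwise Type-I bound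
passes to the limit; `W` is `W₀` cut off to `0` at `t ≥ 0`. The twisted scaling law (`twisted_law_of_limit`): `V_n` is
rotated `c_n^{k_n}`-DSS through the angle `k_nθ_n ≡ k_nθ_n − 2πm_n` (`IsRotatedDSS.rotZ_iterate_sub_two_pi_mul`), the
evaluation points `((c_n^{k_n})²t, c_n^{k_n} R x)` converge inside one slab piece, the convergence is uniform there and
the rotations are jointly continuous in `(angle, vector)` (the tree's `rssCompact_tendsto_rotZ_of_tendsto`, from the sibling RSS
compactness file `TypeICertificateLadderTargetRssCompactnessLimit`, which runs the same extraction for RSS fields with speeds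
`α_n → α₀` in the bounded-weak class). Nontriviality
(`limit_ne_zero_of_witnesses`): Chae–Wolf's Step 1 with rotations (`stub_rdssWitness`) gives witnesses
`t_n ∈ [−c_n², −1]`, `‖x_n‖ ≤ 2C₀/ε₀`, `‖V_n(t_n,x_n)‖ ≥ ε₀/2`, which accumulate at a point `(−1, x̄)` inside one
slab piece.
-/

noncomputable section

open Set Function MeasureTheory Filter Topology Metric Literature.Analysis.FluidPDE

namespace Summit.NavierStokesRegularity.NavierStokesRegularity.Theorems.CorkscrewProfile.Birth

set_option linter.dupNamespace false

/-! ### Cutting a field off at `t ≥ 0` -/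

/-- The Oseen-gauge class only sees negative times: a field agreeing with a member slice-wise on `t < 0` is a member. -/
theorem isTypeIAncientMild_congr_neg {C : ℝ} {W₀ W : ℝ → EuclideanSpace ℝ (Fin 3) → EuclideanSpace ℝ (Fin 3)}
    (hW₀ : IsTypeIAncientMild C W₀) (heq : ∀ t < 0, W t = W₀ t) : IsTypeIAncientMild C W := by
  refine ⟨?_, fun t ht => ?_, fun s t hst ht x => ?_, fun t ht x => ?_⟩
  · refine hW₀.contDiffOn.congr fun p hp => ?_
    rcases p with ⟨t, x⟩
    have ht : t < 0 := (mem_prod.1 hp).1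
    simp only [uncurry_apply_pair, heq t ht]
  · rw [heq t ht]
    exact hW₀.isDivFree ht
  · rw [heq t ht, heq s (hst.trans ht)]
    have e : oseenDuhamel 1 s W W t x = oseenDuhamel 1 s W₀ W₀ t x := by
      simp only [oseenDuhamel]
      refine setIntegral_congr_fun measurableSet_Ioo fun τ hτ => ?_
      simp only [heq τ (hτ.2.trans ht)]
    rw [e]
    exact hW₀.mild_eq hst ht x
  · rw [heq t ht]
    exact hW₀.norm_le ht x

/-! ### Slab pieces -/

/-- Every point of the open past slab lies well inside some slab piece `[−(N+2), −1/(N+2)] × B̄(0, N+2)`. -/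
theorem exists_slabPiece_mem {t : ℝ} (ht : t < 0) (x : EuclideanSpace ℝ (Fin 3)) :
    ∃ N : ℕ, t ∈ Ioo (-((N : ℝ) + 2)) (-(1 / ((N : ℝ) + 2))) ∧ ‖x‖ < (N : ℝ) + 2 := by
  obtain ⟨N, hN⟩ := exists_nat_gt (max (-t) (max (1 / (-t)) ‖x‖))
  have h1 : -t < N := lt_of_le_of_lt (le_max_left _ _) hN
  have h2 : 1 / (-t) < N := lt_of_le_of_lt ((le_max_left _ _).trans (le_max_right _ _)) hN
  have h3 : ‖x‖ < N := lt_of_le_of_lt ((le_max_right _ _).trans (le_max_right _ _)) hN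
  have hN0 : (0 : ℝ) ≤ N := N.cast_nonneg
  refine ⟨N, ⟨by linarith, ?_⟩, by linarith⟩
  have hnt : 0 < -t := neg_pos.2 ht
  have hN2 : (0 : ℝ) < (N : ℝ) + 2 := by linarith
  rw [lt_neg, one_div, inv_lt_comm₀ hN2 hnt]
  calc (-t)⁻¹ = 1 / (-t) := (one_div _).symm
    _ < N := h2
    _ < (N : ℝ) + 2 := by linarith

/-- Continuity of a field continuous on the open past slab, at an interior point, within any set. -/
theorem continuousWithinAt_of_slab {W₀ : ℝ → EuclideanSpace ℝ (Fin 3) → EuclideanSpace ℝ (Fin 3)}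
    (hWc : ContinuousOn (uncurry W₀) (Iio 0 ×ˢ univ)) {t : ℝ} (ht : t < 0) (x : EuclideanSpace ℝ (Fin 3))
    (S : Set (ℝ × EuclideanSpace ℝ (Fin 3))) : ContinuousWithinAt (uncurry W₀) S (t, x) := by
  have hmem : (t, x) ∈ Iio (0 : ℝ) ×ˢ (univ : Set (EuclideanSpace ℝ (Fin 3))) := mk_mem_prod ht (mem_univ _)
  exact (hWc.continuousAt ((isOpen_Iio.prod isOpen_univ).mem_nhds hmem)).continuousWithinAt

/-! ### The twisted scaling law passes to the limit -/

/-- **The twisted scaling law of the limit.** If fields `F_j → W₀` pointwise on the open past and uniformly on the slab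
pieces, `W₀` is continuous on the open past, and each `F_j` is rotated `λ_j`-DSS about `e₃` through the angle `ψ_j`,
with `λ_j → μ > 0` and `ψ_j → Θ₀`, then `W₀(t,x) = μ R_{−Θ₀} W₀(μ²t, μ R_{Θ₀} x)` for `t < 0`. -/
theorem twisted_law_of_limit {W₀ : ℝ → EuclideanSpace ℝ (Fin 3) → EuclideanSpace ℝ (Fin 3)}
    {F : ℕ → ℝ → EuclideanSpace ℝ (Fin 3) → EuclideanSpace ℝ (Fin 3)} {lam ψ : ℕ → ℝ} {μ Θ₀ : ℝ}
    (hWc : ContinuousOn (uncurry W₀) (Iio 0 ×ˢ univ))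
    (hunif : ∀ N : ℕ, TendstoUniformlyOn (fun j => uncurry (F j)) (uncurry W₀) atTop
      (Icc (-((N : ℝ) + 2)) (-(1 / ((N : ℝ) + 2))) ×ˢ closedBall (0 : EuclideanSpace ℝ (Fin 3)) ((N : ℝ) + 2)))
    (hpt : ∀ t < 0, ∀ x, Tendsto (fun j => F j t x) atTop (𝓝 (W₀ t x)))
    (hrd : ∀ j, IsRotatedDSS (lam j) (rotZLIE (ψ j)) (F j))
    (hlam : Tendsto lam atTop (𝓝 μ)) (hψ : Tendsto ψ atTop (𝓝 Θ₀)) (hμ : 0 < μ)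
    {t : ℝ} (ht : t < 0) (x : EuclideanSpace ℝ (Fin 3)) :
    μ • rotZ (-Θ₀) (W₀ (μ ^ 2 * t) (μ • rotZ Θ₀ x)) = W₀ t x := by
  have hμt : μ ^ 2 * t < 0 := mul_neg_of_pos_of_neg (by positivity) ht
  -- the identity along the sequence (`rotZLIE_apply`, `rotZLIE_symm_apply` are definitional)
  have hid : ∀ j, F j t x = lam j • rotZ (-ψ j) (F j (lam j ^ 2 * t) (lam j • rotZ (ψ j) x)) := fun j => by
    rw [← hrd j t x]
    rfl
  -- the evaluation points converge inside one slab piece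
  obtain ⟨N, hNt, hNx⟩ := exists_slabPiece_mem hμt (μ • rotZ Θ₀ x)
  have hz1 : Tendsto (fun j => lam j ^ 2 * t) atTop (𝓝 (μ ^ 2 * t)) := (hlam.pow 2).mul_const t
  have hz2 : Tendsto (fun j => lam j • rotZ (ψ j) x) atTop (𝓝 (μ • rotZ Θ₀ x)) := by
    exact hlam.smul (Summit.NavierStokesRegularity.NavierStokesRegularity.Theorems.rssCompact_tendsto_rotZ_of_tendsto hψ tendsto_const_nhds)
  have hzlim : Tendsto (fun j => (lam j ^ 2 * t, lam j • rotZ (ψ j) x)) atTop (𝓝 (μ ^ 2 * t, μ • rotZ Θ₀ x)) :=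
    hz1.prodMk_nhds hz2
  have hzmem : ∀ᶠ j in atTop, (lam j ^ 2 * t, lam j • rotZ (ψ j) x) ∈
      Icc (-((N : ℝ) + 2)) (-(1 / ((N : ℝ) + 2))) ×ˢ closedBall (0 : EuclideanSpace ℝ (Fin 3)) ((N : ℝ) + 2) := by
    have h1 : ∀ᶠ j in atTop, lam j ^ 2 * t ∈ Ioo (-((N : ℝ) + 2)) (-(1 / ((N : ℝ) + 2))) :=
      hz1 (Ioo_mem_nhds hNt.1 hNt.2)
    have h2 : ∀ᶠ j in atTop, ‖lam j • rotZ (ψ j) x‖ < (N : ℝ) + 2 := hz2.norm (Iio_mem_nhds hNx)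
    filter_upwards [h1, h2] with j hj1 hj2
    exact mk_mem_prod (Ioo_subset_Icc_self hj1) (by rw [mem_closedBall, dist_zero_right]; exact hj2.le)
  have hzw := tendsto_nhdsWithin_iff.2 ⟨hzlim, hzmem⟩
  have hinner : Tendsto (fun j => F j (lam j ^ 2 * t) (lam j • rotZ (ψ j) x)) atTop
      (𝓝 (W₀ (μ ^ 2 * t) (μ • rotZ Θ₀ x))) := by
    have h := (hunif N).tendsto_comp (continuousWithinAt_of_slab hWc hμt (μ • rotZ Θ₀ x) _) hzw
    simpa only [uncurry_apply_pair] using h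
  have hrhs : Tendsto (fun j => lam j • rotZ (-ψ j) (F j (lam j ^ 2 * t) (lam j • rotZ (ψ j) x)))
      atTop (𝓝 (μ • rotZ (-Θ₀) (W₀ (μ ^ 2 * t) (μ • rotZ Θ₀ x)))) := by
    exact hlam.smul (Summit.NavierStokesRegularity.NavierStokesRegularity.Theorems.rssCompact_tendsto_rotZ_of_tendsto hψ.neg hinner)
  have hlhs : Tendsto (fun j => F j t x) atTop (𝓝 (μ • rotZ (-Θ₀) (W₀ (μ ^ 2 * t) (μ • rotZ Θ₀ x)))) :=
    hrhs.congr fun j => (hid j).symm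
  exact (tendsto_nhds_unique (hpt t ht x) hlhs).symm

/-! ### Nontriviality of the limit -/

/-- **The witnesses accumulate.** If `F_j → W₀` uniformly on the slab pieces, `W₀` is continuous on the open past, the
factors `1 < c_j ≤ 2` tend to `1`, and every `F_j` has a witness `t_j ∈ [−c_j², −1]`, `‖x_j‖ ≤ ρ`, `‖F_j(t_j,x_j)‖ ≥ δ`
with `δ > 0`, then `W₀(−1, x̄) ≠ 0` for some `x̄`. -/
theorem limit_ne_zero_of_witnesses {W₀ : ℝ → EuclideanSpace ℝ (Fin 3) → EuclideanSpace ℝ (Fin 3)}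
    {F : ℕ → ℝ → EuclideanSpace ℝ (Fin 3) → EuclideanSpace ℝ (Fin 3)} {c : ℕ → ℝ} {ρ δ : ℝ}
    (hWc : ContinuousOn (uncurry W₀) (Iio 0 ×ˢ univ))
    (hunif : ∀ N : ℕ, TendstoUniformlyOn (fun j => uncurry (F j)) (uncurry W₀) atTop
      (Icc (-((N : ℝ) + 2)) (-(1 / ((N : ℝ) + 2))) ×ˢ closedBall (0 : EuclideanSpace ℝ (Fin 3)) ((N : ℝ) + 2)))
    (hc1 : ∀ j, 1 < c j) (hc2 : ∀ j, c j ≤ 2) (hclim : Tendsto c atTop (𝓝 1)) (hδ : 0 < δ)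
    (hw : ∀ j, ∃ t ∈ Icc (-c j ^ 2) (-1), ∃ x : EuclideanSpace ℝ (Fin 3), ‖x‖ ≤ ρ ∧ δ ≤ ‖F j t x‖) :
    ∃ x, W₀ (-1) x ≠ 0 := by
  choose tw htw xw hxw hnw using hw
  set K : Set (ℝ × EuclideanSpace ℝ (Fin 3)) :=
    Icc (-4 : ℝ) (-1) ×ˢ closedBall (0 : EuclideanSpace ℝ (Fin 3)) ρ with hK
  have hKc : IsCompact K := isCompact_Icc.prod (isCompact_closedBall _ _)
  have hmemK : ∀ j, (tw j, xw j) ∈ K := fun j => by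
    refine mk_mem_prod ⟨?_, (htw j).2⟩ ?_
    · have : c j ^ 2 ≤ 4 := by nlinarith [hc2 j, hc1 j]
      linarith [(htw j).1]
    · rw [mem_closedBall, dist_zero_right]; exact hxw j
  obtain ⟨⟨tbar, xbar⟩, -, ψ, hψ, hconv⟩ := hKc.tendsto_subseq hmemK
  -- the limit time is `-1`
  have ht1 : Tendsto (fun j => tw (ψ j)) atTop (𝓝 (-1)) := by
    have hlow : Tendsto (fun j => -c (ψ j) ^ 2) atTop (𝓝 (-1)) := by
      have := (hclim.comp hψ.tendsto_atTop).pow 2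
      simpa using this.neg
    exact tendsto_of_tendsto_of_tendsto_of_le_of_le hlow tendsto_const_nhds
      (fun j => (htw _).1) fun j => (htw _).2
  have htbar : tbar = -1 :=
    tendsto_nhds_unique ((continuous_fst.tendsto _).comp hconv) ht1
  subst htbar
  -- one slab piece containing `K`
  obtain ⟨N, hN⟩ := exists_nat_ge (max ρ 2)
  have hNρ : ρ ≤ N := (le_max_left _ _).trans hN
  have hN2 : (2 : ℝ) ≤ N := (le_max_right _ _).trans hN
  set S : Set (ℝ × EuclideanSpace ℝ (Fin 3)) :=
    Icc (-((N : ℝ) + 2)) (-(1 / ((N : ℝ) + 2))) ×ˢ closedBall (0 : EuclideanSpace ℝ (Fin 3)) ((N : ℝ) + 2)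
    with hS
  have hKS : K ⊆ S := by
    refine prod_mono (Icc_subset_Icc (by linarith) ?_) (closedBall_subset_closedBall (by linarith))
    rw [neg_le_neg_iff, div_le_iff₀ (by linarith : (0 : ℝ) < (N : ℝ) + 2)]
    linarith
  have hunif' : TendstoUniformlyOn (fun j => uncurry (F (ψ j))) (uncurry W₀) atTop S :=
    fun u hu => hψ.tendsto_atTop.eventually (hunif N u hu)
  have hzw : Tendsto (fun j => (tw (ψ j), xw (ψ j))) atTop (𝓝[S] ((-1 : ℝ), xbar)) :=
    tendsto_nhdsWithin_iff.2 ⟨hconv, Eventually.of_forall fun j => hKS (hmemK (ψ j))⟩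
  have hmain : Tendsto (fun j => F (ψ j) (tw (ψ j)) (xw (ψ j))) atTop (𝓝 (W₀ (-1) xbar)) := by
    have h := hunif'.tendsto_comp (continuousWithinAt_of_slab hWc (by norm_num : (-1 : ℝ) < 0) xbar S) hzw
    simpa only [uncurry_apply_pair] using h
  have hge : δ ≤ ‖W₀ (-1) xbar‖ := ge_of_tendsto' hmain.norm fun j => hnw (ψ j)
  refine ⟨xbar, fun h0 => ?_⟩
  rw [h0, norm_zero] at hge
  linarith

/-! ### The compactness step -/

/-- **Registered tool stub F4 `stub_rdssTunedCompactness`** (see the module docstring). [cite: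
KochNadirashviliSereginSverak2009, Lemma 6.1 (arXiv:0709.3599 p. 11); ChaeWolf2017RemovingDSS, §3 Steps 1–2] -/
theorem stub_rdssTunedCompactness :
    ∀ (C₀ : ℝ) (c θ : ℕ → ℝ) (Θ : ℝ → ℝ) (V : ℕ → ℝ → EuclideanSpace ℝ (Fin 3) → EuclideanSpace ℝ (Fin 3)),
      0 < C₀ → (∀ n, 1 < c n) → (∀ n, c n ≤ 2) → Filter.Tendsto c Filter.atTop (nhds 1) →
      (∀ n, Literature.Analysis.FluidPDE.IsTypeIAncientMild C₀ (V n)) →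
      (∀ n, Literature.Analysis.FluidPDE.HasTypeIDecay C₀ (V n)) →
      (∀ n, Literature.Analysis.FluidPDE.IsRotatedDSS (c n) (Literature.Analysis.FluidPDE.rotZLIE (θ n)) (V n)) →
      (∀ n, ∃ t < 0, ∃ x, V n t x ≠ 0) →
      (∀ μ : ℝ, 1 ≤ μ → ∃ (k : ℕ → ℕ) (m : ℕ → ℤ), Filter.Tendsto (fun n => c n ^ k n) Filter.atTop (nhds μ) ∧
        Filter.Tendsto (fun n => (k n : ℝ) * θ n - 2 * Real.pi * (m n : ℝ)) Filter.atTop (nhds (Θ μ))) →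
      ∃ W : ℝ → EuclideanSpace ℝ (Fin 3) → EuclideanSpace ℝ (Fin 3),
        Literature.Analysis.FluidPDE.IsTypeIAncientMild C₀ W ∧ Literature.Analysis.FluidPDE.HasTypeIDecay C₀ W ∧
        (∀ t, 0 ≤ t → W t = 0) ∧
        (∀ μ : ℝ, 1 ≤ μ → Literature.Analysis.FluidPDE.IsRotatedDSS μ (Literature.Analysis.FluidPDE.rotZLIE (Θ μ)) W) ∧
        ∃ x, W (-1) x ≠ 0 := by
  intro C₀ c θ Θ V _hC₀ hc1 hc2 hclim hV hdec hrdss hnt htune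
  -- ## Step 1: KNSS Lemma 6.1 in the rate form
  have hAlim : Tendsto (fun k : ℕ => -((k : ℝ) + 1)) atTop atBot :=
    tendsto_neg_atTop_atBot.comp (tendsto_natCast_atTop_atTop.atTop_add tendsto_const_nhds)
  have hrate : ∀ n, ∀ τ < (0 : ℝ), ∀ x, Real.sqrt (-τ) * ‖V n τ x‖ ≤ C₀ := fun n τ hτ x => by
    have hpos : 0 < Real.sqrt (-τ) := Real.sqrt_pos.2 (neg_pos.2 hτ)
    have h := (hV n).norm_le hτ x
    rw [le_div_iff₀ hpos] at h
    linarith [mul_comm (Real.sqrt (-τ)) ‖V n τ x‖]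
  obtain ⟨φ, W₀, hφ, hWc, hWdiv, hWI, hWmild, hunif, hpt, -⟩ :=
    KNSS2009_lemma61_typeI_rate (A := fun k : ℕ => -((k : ℝ) + 1)) (w := V) (C := C₀) hAlim
      (fun k => (hV k).continuousOn_uncurry.mono (prod_mono (fun t ht => ht.2) subset_rfl))
      (fun k t ht => (hV k).isWeaklyDivFree ht.2)
      (fun k s t _ hst ht x => (hV k).mild_eq_heatExtension hst ht x)
      (fun k τ hτ x => hrate k τ hτ.2 x)
  -- ## Step 2: the limit is an Oseen-gauge Type-I field; cut it off at `t ≥ 0`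
  have hWI' : HasTypeITimeDecay C₀ W₀ := fun t ht x => by
    have hpos : 0 < Real.sqrt (-t) := Real.sqrt_pos.2 (neg_pos.2 ht)
    rw [le_div_iff₀ hpos, mul_comm]
    exact hWI t ht x
  have hW₀ : IsTypeIAncientMild C₀ W₀ :=
    Summit.NavierStokesRegularity.NavierStokesRegularity.Theorems.isTypeIAncientMild_of_continuous_oseenMild
      hWc hWdiv hWmild hWI'
  obtain ⟨W, hWneg, hWnonneg⟩ : ∃ W : ℝ → EuclideanSpace ℝ (Fin 3) → EuclideanSpace ℝ (Fin 3),
      (∀ t < 0, W t = W₀ t) ∧ ∀ t, 0 ≤ t → W t = 0 :=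
    ⟨fun t => if t < 0 then W₀ t else 0, fun t ht => if_pos ht, fun t ht => if_neg (not_lt.2 ht)⟩
  have hW : IsTypeIAncientMild C₀ W := isTypeIAncientMild_congr_neg hW₀ hWneg
  -- the pointwise Type-I bound passes to the limit
  have hWdec : HasTypeIDecay C₀ W := fun t ht x => by
    rw [hWneg t ht]
    exact le_of_tendsto' (hpt t ht x).norm fun j => hdec (φ j) t ht x
  refine ⟨W, hW, hWdec, hWnonneg, fun μ hμ => ?_, ?_⟩
  · -- ## Step 3: the twisted scaling law along the tuned exponents
    obtain ⟨k, m, hk, hm⟩ := htune μ hμ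
    have hμ0 : 0 < μ := one_pos.trans_le hμ
    have hrd : ∀ j, IsRotatedDSS (c (φ j) ^ k (φ j))
        (rotZLIE ((k (φ j) : ℝ) * θ (φ j) - 2 * Real.pi * (m (φ j) : ℝ))) (V (φ j)) := fun j =>
      IsRotatedDSS.rotZ_iterate_sub_two_pi_mul (hrdss (φ j)) (k (φ j)) (m (φ j))
    intro t x
    by_cases ht : t < 0
    · have hμt : μ ^ 2 * t < 0 := mul_neg_of_pos_of_neg (by positivity) ht
      rw [rotZLIE_apply, rotZLIE_symm_apply, hWneg t ht, hWneg _ hμt]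
      exact twisted_law_of_limit (F := fun j => V (φ j)) (lam := fun j => c (φ j) ^ k (φ j))
        (ψ := fun j => (k (φ j) : ℝ) * θ (φ j) - 2 * Real.pi * (m (φ j) : ℝ)) hWc hunif hpt hrd
        (hk.comp hφ.tendsto_atTop) (hm.comp hφ.tendsto_atTop) hμ0 ht x
    · -- junk times: both sides vanish
      have ht0 : 0 ≤ t := not_lt.1 ht
      rw [hWnonneg t ht0, hWnonneg _ (mul_nonneg (sq_nonneg μ) ht0), Pi.zero_apply, Pi.zero_apply, map_zero,
        smul_zero]
  · -- ## Step 4: nontriviality at `t = -1`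
    obtain ⟨ε₀, hε₀, hwit⟩ := stub_rdssWitness
    obtain ⟨x, hx⟩ := limit_ne_zero_of_witnesses (F := fun j => V (φ j)) (c := fun j => c (φ j)) (ρ := 2 * C₀ / ε₀)
      hWc hunif (fun j => hc1 _) (fun j => hc2 _) (hclim.comp hφ.tendsto_atTop) (half_pos hε₀)
      fun j => hwit C₀ (c (φ j)) (θ (φ j)) (V (φ j)) (hc1 _) (hc2 _) (hV _) (hdec _) (hrdss _) (hnt _)
    exact ⟨x, by rwa [hWneg (-1) (by norm_num)]⟩

end Summit.NavierStokesRegularity.NavierStokesRegularity.Theorems.CorkscrewProfile.Birth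

end
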